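import Literature.NumberTheory.EllipticCurves.BernoulliMeasureMomentsProofs
import Literature.NumberTheory.EllipticCurves.PAdicMeasureInversionProofs
import HarnessLib

/-!
# The Iwasawa power series of the Kubota–Leopoldt measure `θ E_{1,c}` and its values at `γ^{±j} − 1`
# (Lang Ch. 4 §1 Ex. 2, §3 Thm. 3.2)

Lang, *Cyclotomic Fields I and II*, Ch. 4 §3 (PDF p. 84): for a Dirichlet character `χ` and `c`
prime to its conductor and to `p`,
`L_p(1−s, χ) = −(1 − χ(c)⟨c⟩^s)⁻¹ M_p(χE_{1,c})(s)`, and (proof of Thm. 3.2)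
`M_p(χE_{1,c})(k) = ∫_{ℤ_p^*} ⟨a⟩^{k-1} χ(a)ω(a)⁻¹ dE_{1,c}(a) = ∫ a^{k-1} ω(a)^{-k}χ(a) dE_{1,c}(a)
= (1 − χω^{-k}(c) c^k)(1/k) B_{k,χω^{-k}}` (by Ch. 2 Thm. 2.4).  In Iwasawa's variable (§1 Ex. 2,
`∫ u^s dν(u) = f(γ^s − 1)`) this says: the power series `f` of the measure `θ E_{1,c}`
(`θ = χω⁻¹` as a function on the integers) satisfies
`f(γ^{j} − 1) = (1 − θ_j(c)c^{j+1}) (1/(j+1)) B_{j+1,θ_j}` with `θ_j = θ ω^{-j}`.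

This file proves exactly this, for an arbitrary `N`-periodic `θ : ℕ → ℤ_p` vanishing on the
multiples of `p` (odd `p`, `c` prime to `Np`), with the twist `θ_j` supplied abstractly through the
relation `θ_j(b) η^j = θ(b)` for `b ≡ η (mod p)`, `η` a Teichmüller representative:

* `exists_transforms_bernoulliMeasure` — there are `f, f̌ ∈ ℚ_p⟦T⟧` with coefficients of norm
  `≤ 1` (the transforms of `θE_{1,c}` and of its inversion `x ↦ x⁻¹`) such that for every `j` and
  every such twist `θ_j`,
  `f(γ^j − 1) = f̌(γ^{-j} − 1) = (1/(j+1)) (1 − θ_j(c) c^{j+1}) ∑_{b mod N} θ_j(b) N^{j} B_{j+1}(b/N)`.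

Everything is proved; there are no named facts.

## References

* S. Lang, *Cyclotomic Fields I and II*, GTM 121, Springer 1990, Ch. 2 §2 Thm. 2.4 (PDF p. 38),
  Ch. 4 §1 Example 2 (PDF p. 79), §3 Thm. 3.2 and its proof (PDF p. 84). [LangCyclotomic1990]
-/

noncomputable section

open scoped Classical

open Filter Topology Finset

namespace Literature.NumberTheory.EllipticCurves

variable (p : ℕ) [Fact p.Prime] {N : ℕ} [NeZero N] {c : ℕ} {θ : ℕ → ℤ_[p]}

/-! ### Auxiliary facts on classes -/

omit [NeZero N] in
/-- Any ring homomorphism `ℤ_p → ℤ/pℤ` is the reduction map. [folklore] -/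
private theorem ringHom_eq_toZMod (φ : ℤ_[p] →+* ZMod p) : φ = PadicInt.toZMod := by
  apply ZMod.ringHom_eq_of_ker_eq
  rw [PadicInt.ker_toZMod]
  refine ((IsLocalRing.maximalIdeal.isMaximal ℤ_[p]).eq_of_le (RingHom.ker_ne_top φ) ?_).symm
  rw [PadicInt.maximalIdeal_eq_span_p, Ideal.span_le, Set.singleton_subset_iff, SetLike.mem_coe,
    RingHom.mem_ker, map_natCast, ZMod.natCast_self]

/-- A non-unit class modulo `p^n`, `n ≥ 1`, has `val` divisible by `p`. [folklore] -/
private theorem dvd_val_of_not_isUnit {n : ℕ} {a : ZMod (p ^ n)} (ha : ¬ IsUnit a) :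
    p ∣ a.val := by
  haveI : NeZero (p ^ n) := ⟨pow_ne_zero _ (Fact.out : p.Prime).ne_zero⟩
  by_contra h
  apply ha
  have hcop : a.val.Coprime (p ^ n) :=
    Nat.Coprime.pow_right _ ((Nat.Prime.coprime_iff_not_dvd Fact.out).mpr h).symm
  have := (ZMod.isUnit_iff_coprime a.val (p ^ n)).mpr hcop
  rwa [ZMod.natCast_zmod_val] at this

/-- **`θE_{k,c}` vanishes on the non-unit classes of positive level** when `θ` vanishes on the
multiples of `p`. [folklore] -/
private theorem bernoulliMeasure_eq_zero_of_not_isUnit (hθp : ∀ b, p ∣ b → θ b = 0) (k : ℕ)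
    {n : ℕ} (hn : 1 ≤ n) (a : ZMod (p ^ n)) (ha : ¬ IsUnit a) :
    bernoulliMeasure p N c θ k n a = 0 := by
  unfold bernoulliMeasure
  refine Finset.sum_eq_zero fun b hb ↦ ?_
  have hb' := (Finset.mem_filter.mp hb).2
  have hmod : b.val % p ^ n = a.val := by
    have h := congr_arg ZMod.val hb'
    rwa [ZMod.castHom_apply, ZMod.cast_eq_val, ZMod.val_natCast] at h
  have hdvd : p ∣ b.val := by
    have h1 : p ∣ a.val := dvd_val_of_not_isUnit p ha
    have h2 : p ∣ p ^ n := dvd_pow_self p (by omega)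
    rw [← Nat.mod_add_div b.val (p ^ n), hmod]
    exact dvd_add h1 (dvd_mul_of_dvd_left h2 _)
  rw [hθp _ hdvd, PadicInt.coe_zero, zero_mul]

/-- On the class of `η γ^s` modulo `p^{n+e₀}`, every `b` reduces to `η` modulo `p`. [folklore] -/
private theorem natCast_val_eq_toZMod_of_castHom_eq {L : ℕ} (hL : 1 ≤ L)
    {b : ZMod (N * p ^ L)} {η : rootsOfUnity (torsionOrder p) ℤ_[p]} {s : ℕ}
    (hb : ZMod.castHom (Dvd.intro_left N rfl) (ZMod (p ^ L)) b =
      PadicInt.toZModPow L ((η : ℤ_[p]ˣ) : ℤ_[p]) * (cyclotomicGenerator p : ZMod (p ^ L)) ^ s) :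
    (b.val : ZMod p) = PadicInt.toZMod ((η : ℤ_[p]ˣ) : ℤ_[p]) := by
  haveI : NeZero (N * p ^ L) := inferInstance
  have hpL : p ∣ p ^ L := dvd_pow_self p (by omega)
  have h := congr_arg (ZMod.castHom hpL (ZMod p)) hb
  rw [map_mul, map_pow, map_natCast, ZMod.castHom_apply, ZMod.castHom_apply, ZMod.cast_eq_val,
    ZMod.cast_eq_val, ZMod.val_natCast] at h
  have e : ((b.val % p ^ L : ℕ) : ZMod p) = (b.val : ZMod p) :=
    (ZMod.natCast_eq_natCast_iff' _ _ _).mpr (by rw [Nat.mod_mod_of_dvd _ hpL])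
  rw [← e, h]
  have hγ : (cyclotomicGenerator p : ZMod p) = 1 := by
    rw [cyclotomicGenerator, Nat.cast_add, Nat.cast_one, Nat.cast_pow, ZMod.natCast_self,
      zero_pow (cyclotomicExponent_ne_zero p), add_zero]
  rw [hγ, one_pow, mul_one]
  have hφ := ringHom_eq_toZMod p ((ZMod.castHom hpL (ZMod p)).comp (PadicInt.toZModPow L))
  have := RingHom.congr_fun hφ ((η : ℤ_[p]ˣ) : ℤ_[p])
  rwa [RingHom.comp_apply] at this

omit [Fact p.Prime] [NeZero N] in
/-- Summing a function of `b.val` over `ℤ/Mℤ` is summing over `0 ≤ i < M`. [folklore] -/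
private theorem sum_univ_zmod_apply_val_eq {M : ℕ} [NeZero M] {R : Type*} [AddCommMonoid R]
    (G : ℕ → R) : ∑ b : ZMod M, G b.val = ∑ i ∈ Finset.range M, G i := by
  obtain ⟨M', rfl⟩ := Nat.exists_eq_succ_of_ne_zero (NeZero.ne M)
  exact Fin.sum_univ_eq_sum_range G (M' + 1)

/-- The level-`N·p^0` sum `∑_b θ'(b) · (Np⁰)^{k-1} B_k(b.val/(Np⁰))` is `N^{k-1} ∑_{i<N} θ'(i) B_k(i/N)`
(`k · B_{k,θ'}/?` in Lang's notation **B 7**: `B_{k,f} = N^{k-1} ∑_{a=0}^{N-1} f(a) B_k(a/N)`).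
[cite: LangCyclotomic1990, Ch. 2 §2, B 7 (PDF p. 35)] -/
theorem sum_bernoulliDist_level_zero_eq (θ' : ℕ → ℤ_[p]) (k : ℕ) :
    ∑ b : ZMod (N * p ^ 0), ((θ' b.val : ℤ_[p]) : ℚ_[p]) *
        ((bernoulliDist k (N * p ^ 0) b : ℚ) : ℚ_[p]) =
      (N : ℚ_[p]) ^ (k - 1) * ∑ i ∈ Finset.range N, ((θ' i : ℤ_[p]) : ℚ_[p]) *
        (((Polynomial.bernoulli k).eval ((i : ℚ) / N) : ℚ) : ℚ_[p]) := by
  unfold bernoulliDist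
  rw [sum_univ_zmod_apply_val_eq (M := N * p ^ 0) (fun i ↦ ((θ' i : ℤ_[p]) : ℚ_[p]) *
    ((((N * p ^ 0 : ℕ) : ℚ) ^ (k - 1) * (Polynomial.bernoulli k).eval ((i : ℚ) / ((N * p ^ 0 : ℕ) : ℚ)) : ℚ) :
      ℚ_[p]))]
  simp only [pow_zero, mul_one, Finset.mul_sum]
  refine Finset.sum_congr rfl fun i _ ↦ ?_
  push_cast
  ring

/-! ### The transforms and their values -/

/-- **The twist relation on the classes**: if `θ'(b) η^j = θ(b)` whenever `b ≡ η (mod p)` (`θ' = θω^{-j}`),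
then `(θ'E_{1,c})(ηγ^s + p^{n+e₀}) · η^j = (θE_{1,c})(ηγ^s + p^{n+e₀})`. [folklore] -/
private theorem bernoulliMeasure_twist {θ' : ℕ → ℤ_[p]} {j : ℕ}
    (hθ' : ∀ (b : ℕ) (η : rootsOfUnity (torsionOrder p) ℤ_[p]),
      (b : ZMod p) = PadicInt.toZMod ((η : ℤ_[p]ˣ) : ℤ_[p]) →
        θ' b * ((η : ℤ_[p]ˣ) : ℤ_[p]) ^ j = θ b)
    (n : ℕ) (η : rootsOfUnity (torsionOrder p) ℤ_[p]) (s : ZMod (p ^ n)) :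
    bernoulliMeasure p N c θ' 1 (n + cyclotomicExponent p)
        (PadicInt.toZModPow (n + cyclotomicExponent p) ((η : ℤ_[p]ˣ) : ℤ_[p]) *
          (cyclotomicGenerator p : ZMod (p ^ (n + cyclotomicExponent p))) ^ s.val) *
        (((η : ℤ_[p]ˣ) : ℤ_[p]) : ℚ_[p]) ^ j =
      bernoulliMeasure p N c θ 1 (n + cyclotomicExponent p)
        (PadicInt.toZModPow (n + cyclotomicExponent p) ((η : ℤ_[p]ˣ) : ℤ_[p]) *
          (cyclotomicGenerator p : ZMod (p ^ (n + cyclotomicExponent p))) ^ s.val) := by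
  unfold bernoulliMeasure
  rw [Finset.sum_mul]
  refine Finset.sum_congr rfl fun b hb ↦ ?_
  have hb' := (Finset.mem_filter.mp hb).2
  have hL : 1 ≤ n + cyclotomicExponent p :=
    le_add_left (Nat.pos_of_ne_zero (cyclotomicExponent_ne_zero p))
  have hrel := hθ' b.val η (natCast_val_eq_toZMod_of_castHom_eq p hL hb')
  rw [mul_right_comm, ← PadicInt.coe_pow, ← PadicInt.coe_mul, hrel]

/-- **The Iwasawa power series of `θE_{1,c}` and of its inversion, with their values at
`γ^{±j} − 1`** (Lang Ch. 4 §1 Ex. 2 `∫ u^s dν = f(γ^s − 1)`; §3 proof of Thm. 3.2: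
`M_p(χE_{1,c})(k) = ∫ a^{k-1}ω(a)^{-k}χ(a) dE_{1,c}(a) = (1 − χω^{-k}(c)c^k)(1/k)B_{k,χω^{-k}}`).
For an odd prime `p`, `θ : ℕ → ℤ_p` of period `N` vanishing on the multiples of `p`, and `c` prime to
`Np`: there are `f, f̌ ∈ ℚ_p⟦T⟧` with coefficients of norm `≤ 1` (the transforms of the measure
`θE_{1,c}` on `ℤ_p^×` and of its image under `x ↦ x⁻¹`) such that for every `j` and every
`N`-periodic `θ'` vanishing on the multiples of `p`, multiplicative with respect to `c` and twisting
`θ` by `ω^{-j}` (`θ'(b)η^j = θ(b)` for `b ≡ η mod p`, `η ∈ μ_{p−1}(ℤ_p)`):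
`f(γ^j − 1) = f̌(γ^{-j} − 1) = (1/(j+1))(1 − θ'(c)c^{j+1}) ∑_{b mod N} θ'(b) N^{j}B_{j+1}(b.val/N)`.
[cite: LangCyclotomic1990, Ch. 4 §1 Example 2 (PDF p. 79) and §3 Thm. 3.2 with its proof (PDF p. 84); Ch. 2 §2 Thm. 2.4 (PDF p. 38)] -/
theorem exists_transforms_bernoulliMeasure (hp : p ≠ 2) (hc : c.Coprime (N * p))
    (hθ : ∀ b, θ (b + N) = θ b) (hθp : ∀ b, p ∣ b → θ b = 0) :
    ∃ f g : PowerSeries ℚ_[p],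
      (∀ k, ‖PowerSeries.coeff k f‖ ≤ 1) ∧ (∀ k, ‖PowerSeries.coeff k g‖ ≤ 1) ∧
      ∀ (j : ℕ) (θ' : ℕ → ℤ_[p]), (∀ b, θ' (b + N) = θ' b) → (∀ b, p ∣ b → θ' b = 0) →
        (∀ x, θ' (c * x) = θ' c * θ' x) →
        (∀ (b : ℕ) (η : rootsOfUnity (torsionOrder p) ℤ_[p]),
          (b : ZMod p) = PadicInt.toZMod ((η : ℤ_[p]ˣ) : ℤ_[p]) →
            θ' b * ((η : ℤ_[p]ˣ) : ℤ_[p]) ^ j = θ b) →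
        HasSum (fun k : ℕ ↦ PowerSeries.coeff k f *
            (((cyclotomicGenerator p : ℕ) : ℚ_[p]) ^ j - 1) ^ k)
          (((j + 1 : ℕ) : ℚ_[p])⁻¹ * (1 - ((θ' c : ℤ_[p]) : ℚ_[p]) * (c : ℚ_[p]) ^ (j + 1)) *
            ((N : ℚ_[p]) ^ j * ∑ i ∈ Finset.range N, ((θ' i : ℤ_[p]) : ℚ_[p]) *
              (((Polynomial.bernoulli (j + 1)).eval ((i : ℚ) / N) : ℚ) : ℚ_[p]))) ∧
        HasSum (fun k : ℕ ↦ PowerSeries.coeff k g *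
            ((((cyclotomicGenerator p : ℕ) : ℚ_[p])⁻¹) ^ j - 1) ^ k)
          (((j + 1 : ℕ) : ℚ_[p])⁻¹ * (1 - ((θ' c : ℤ_[p]) : ℚ_[p]) * (c : ℚ_[p]) ^ (j + 1)) *
            ((N : ℚ_[p]) ^ j * ∑ i ∈ Finset.range N, ((θ' i : ℤ_[p]) : ℚ_[p]) *
              (((Polynomial.bernoulli (j + 1)).eval ((i : ℚ) / N) : ℚ) : ℚ_[p]))) := by
  -- the measure `μ = θE_{1,c}` and its inversion
  set μ : (n : ℕ) → ZMod (p ^ n) → ℚ_[p] := bernoulliMeasure p N c θ 1 with hμ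
  have hdist : ∀ (n : ℕ) (a : ZMod (p ^ n)),
      ∑ b ∈ Finset.univ.filter (fun b : ZMod (p ^ (n + 1)) ↦
        ZMod.castHom (pow_dvd_pow p n.le_succ) (ZMod (p ^ n)) b = a), μ (n + 1) b = μ n a :=
    sum_fiber_bernoulliMeasure hc hθ le_rfl
  have hbound : ∀ (n : ℕ) (a : ZMod (p ^ n)), ‖μ n a‖ ≤ 1 :=
    norm_bernoulliMeasure_one_le_one p hp hc
  have h0 : ∀ n : ℕ, 1 ≤ n → ∀ a : ZMod (p ^ n), ¬ IsUnit a → μ n a = 0 :=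
    fun n hn a ha ↦ bernoulliMeasure_eq_zero_of_not_isUnit p hθp 1 hn a ha
  obtain ⟨f, hf, hftend, -, -⟩ := exists_powerSeries_of_bounded_distribution' hdist hbound
  have hdist' := invUnitsDist_distribution hdist h0
  have hbound' : ∀ (n : ℕ) (a : ZMod (p ^ n)), ‖invUnitsDist μ n a‖ ≤ 1 :=
    norm_invUnitsDist_le hbound
  obtain ⟨g, hg, hgtend, -, -⟩ := exists_powerSeries_of_bounded_distribution' hdist' hbound'
  refine ⟨f, g, hf, hg, fun j θ' hθ'N hθ'p hθ'c hθ'ω ↦ ?_⟩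
  -- the twist `μ' = θ'E_{1,c}` and its `j`-th moment distribution `ν = θ'E_{j+1,c}`
  set μ' : (n : ℕ) → ZMod (p ^ n) → ℚ_[p] := bernoulliMeasure p N c θ' 1 with hμ'
  set ν : (n : ℕ) → ZMod (p ^ n) → ℚ_[p] := bernoulliMeasure p N c θ' (j + 1) with hν
  obtain ⟨C, hC1, hCν⟩ := exists_norm_bernoulliMeasure_sub_le p (θ := θ') hp hc
    (k := j + 1) (by omega)
  have hC : ∀ (n : ℕ) (a : ZMod (p ^ n)), ‖μ n a‖ ≤ C := fun n a ↦ (hbound n a).trans hC1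
  have hCinv : ∀ (n : ℕ) (a : ZMod (p ^ n)), ‖invUnitsDist μ n a‖ ≤ C :=
    fun n a ↦ (hbound' n a).trans hC1
  have hC' : ∀ (n : ℕ) (a : ZMod (p ^ n)), ‖μ' n a‖ ≤ C :=
    fun n a ↦ (norm_bernoulliMeasure_one_le_one p hp hc n a).trans hC1
  have hνdist : ∀ (n : ℕ) (a : ZMod (p ^ n)),
      ∑ b ∈ Finset.univ.filter (fun b : ZMod (p ^ (n + 1)) ↦
        ZMod.castHom (pow_dvd_pow p n.le_succ) (ZMod (p ^ n)) b = a), ν (n + 1) b = ν n a :=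
    sum_fiber_bernoulliMeasure hc hθ'N (by omega)
  have hνest : ∀ (n : ℕ) (a : ZMod (p ^ n)),
      ‖ν n a - ((a.val : ℕ) : ℚ_[p]) ^ j * μ' n a‖ ≤ C * (p : ℝ) ^ (-(n : ℤ)) := by
    intro n a
    have h := hCν n a
    rwa [Nat.add_sub_cancel] at h
  have htwist := bernoulliMeasure_twist p (N := N) (c := c) hθ'ω
  -- the value
  have hval : ν 0 0 - ν 1 0 =
      ((j + 1 : ℕ) : ℚ_[p])⁻¹ * (1 - ((θ' c : ℤ_[p]) : ℚ_[p]) * (c : ℚ_[p]) ^ (j + 1)) *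
        ((N : ℚ_[p]) ^ j * ∑ i ∈ Finset.range N, ((θ' i : ℤ_[p]) : ℚ_[p]) *
          (((Polynomial.bernoulli (j + 1)).eval ((i : ℚ) / N) : ℚ) : ℚ_[p])) := by
    rw [hν, bernoulliMeasure_zero_eq p hc hθ'N hθ'c (j + 1),
      bernoulliMeasure_one_zero_eq_zero p hθ'p (j + 1), sub_zero,
      sum_bernoulliDist_level_zero_eq p θ' (j + 1), Nat.add_sub_cancel]
  refine ⟨?_, ?_⟩
  · rw [← hval]
    exact hasSum_coeff_mul_cyclotomicGenerator_pow_sub_one_of_twist hC hC' hftend htwist hνdist hνest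
  · rw [← hval]
    exact hasSum_coeff_mul_cyclotomicGenerator_inv_pow_sub_one_of_twist hCinv hC' hgtend
      (fun n η s ↦ invUnitsDist_classMap n η s) htwist hνdist hνest

/-! ### The same transforms, with their values at the character points `ρ(γ) − 1` retained -/

/-- **The Iwasawa power series of `θE_{1,c}` and of its inversion, with their values at
`γ^{±j} − 1` AND at the character points `ρ(γ) − 1`** (Lang Ch. 4 §1 Ex. 2 and §3 Thm. 3.2 as in
`exists_transforms_bernoulliMeasure`; in addition Mazur–Tate–Teitelbaum 1986 §I.13 / Washington
§12.2: the value of the transform `f(T) = ∫ (1+T)^{ℓ(x)} dμ(x)` at `T = ρ(γ) − 1`, for `ρ` a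
character of `Γ` of conductor `p^{m+1}` (even, `p`-power order, values in `ℂ_p`), is the character
sum `∫ ρ dμ = ∑_{a mod p^{m+1}} ρ(a) μ(a + p^{m+1}ℤ_p)`). Same hypotheses and same `f, f̌` as
`exists_transforms_bernoulliMeasure` (the transforms produced by
`exists_powerSeries_of_bounded_distribution'`, whose clause (iii) is now kept): for every `m` and
every such `ρ`, `f(ρ(γ) − 1) = ∑_a ρ(a)·(θE_{1,c})(a + p^{m+1}ℤ_p)` and
`f̌(ρ(γ) − 1) = ∑_a ρ(a)·(θE_{1,c})ˇ(a + p^{m+1}ℤ_p)` in `ℂ_p`.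
[cite: LangCyclotomic1990, Ch. 4 §1 Example 2 (PDF p. 79) and §3 Thm. 3.2 with its proof (PDF p. 84)]
[cite: MazurTateTeitelbaum1986, §I.13 (values of the transform at the characters of Γ)] -/
theorem exists_transforms_bernoulliMeasure_character (hp : p ≠ 2) (hc : c.Coprime (N * p))
    (hθ : ∀ b, θ (b + N) = θ b) (hθp : ∀ b, p ∣ b → θ b = 0) :
    ∃ f g : PowerSeries ℚ_[p],
      (∀ k, ‖PowerSeries.coeff k f‖ ≤ 1) ∧ (∀ k, ‖PowerSeries.coeff k g‖ ≤ 1) ∧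
      (∀ (j : ℕ) (θ' : ℕ → ℤ_[p]), (∀ b, θ' (b + N) = θ' b) → (∀ b, p ∣ b → θ' b = 0) →
        (∀ x, θ' (c * x) = θ' c * θ' x) →
        (∀ (b : ℕ) (η : rootsOfUnity (torsionOrder p) ℤ_[p]),
          (b : ZMod p) = PadicInt.toZMod ((η : ℤ_[p]ˣ) : ℤ_[p]) →
            θ' b * ((η : ℤ_[p]ˣ) : ℤ_[p]) ^ j = θ b) →
        HasSum (fun k : ℕ ↦ PowerSeries.coeff k f *
            (((cyclotomicGenerator p : ℕ) : ℚ_[p]) ^ j - 1) ^ k)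
          (((j + 1 : ℕ) : ℚ_[p])⁻¹ * (1 - ((θ' c : ℤ_[p]) : ℚ_[p]) * (c : ℚ_[p]) ^ (j + 1)) *
            ((N : ℚ_[p]) ^ j * ∑ i ∈ Finset.range N, ((θ' i : ℤ_[p]) : ℚ_[p]) *
              (((Polynomial.bernoulli (j + 1)).eval ((i : ℚ) / N) : ℚ) : ℚ_[p]))) ∧
        HasSum (fun k : ℕ ↦ PowerSeries.coeff k g *
            ((((cyclotomicGenerator p : ℕ) : ℚ_[p])⁻¹) ^ j - 1) ^ k)
          (((j + 1 : ℕ) : ℚ_[p])⁻¹ * (1 - ((θ' c : ℤ_[p]) : ℚ_[p]) * (c : ℚ_[p]) ^ (j + 1)) *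
            ((N : ℚ_[p]) ^ j * ∑ i ∈ Finset.range N, ((θ' i : ℤ_[p]) : ℚ_[p]) *
              (((Polynomial.bernoulli (j + 1)).eval ((i : ℚ) / N) : ℚ) : ℚ_[p])))) ∧
      (∀ (m : ℕ) (ρ : DirichletCharacter ℂ_[p] (p ^ (m + 1))), ρ.Even →
        (∃ j : ℕ, orderOf ρ = p ^ j) →
          HasSum (fun k : ℕ ↦ algebraMap ℚ_[p] ℂ_[p] (PowerSeries.coeff k f) *
              (ρ (cyclotomicGenerator p : ZMod (p ^ (m + 1))) - 1) ^ k)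
            (∑ a : ZMod (p ^ (m + 1)),
              ρ a * algebraMap ℚ_[p] ℂ_[p] (bernoulliMeasure p N c θ 1 (m + 1) a)) ∧
          HasSum (fun k : ℕ ↦ algebraMap ℚ_[p] ℂ_[p] (PowerSeries.coeff k g) *
              (ρ (cyclotomicGenerator p : ZMod (p ^ (m + 1))) - 1) ^ k)
            (∑ a : ZMod (p ^ (m + 1)),
              ρ a * algebraMap ℚ_[p] ℂ_[p]
                (invUnitsDist (bernoulliMeasure p N c θ 1) (m + 1) a))) := by
  -- the measure `μ = θE_{1,c}` and its inversion
  set μ : (n : ℕ) → ZMod (p ^ n) → ℚ_[p] := bernoulliMeasure p N c θ 1 with hμ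
  have hdist : ∀ (n : ℕ) (a : ZMod (p ^ n)),
      ∑ b ∈ Finset.univ.filter (fun b : ZMod (p ^ (n + 1)) ↦
        ZMod.castHom (pow_dvd_pow p n.le_succ) (ZMod (p ^ n)) b = a), μ (n + 1) b = μ n a :=
    sum_fiber_bernoulliMeasure hc hθ le_rfl
  have hbound : ∀ (n : ℕ) (a : ZMod (p ^ n)), ‖μ n a‖ ≤ 1 :=
    norm_bernoulliMeasure_one_le_one p hp hc
  have h0 : ∀ n : ℕ, 1 ≤ n → ∀ a : ZMod (p ^ n), ¬ IsUnit a → μ n a = 0 :=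
    fun n hn a ha ↦ bernoulliMeasure_eq_zero_of_not_isUnit p hθp 1 hn a ha
  obtain ⟨f, hf, hftend, -, hfchar⟩ := exists_powerSeries_of_bounded_distribution' hdist hbound
  have hdist' := invUnitsDist_distribution hdist h0
  have hbound' : ∀ (n : ℕ) (a : ZMod (p ^ n)), ‖invUnitsDist μ n a‖ ≤ 1 :=
    norm_invUnitsDist_le hbound
  obtain ⟨g, hg, hgtend, -, hgchar⟩ := exists_powerSeries_of_bounded_distribution' hdist' hbound'
  refine ⟨f, g, hf, hg, fun j θ' hθ'N hθ'p hθ'c hθ'ω ↦ ?_,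
    fun m ρ heven hord ↦ ⟨hfchar m ρ heven hord, hgchar m ρ heven hord⟩⟩
  -- the twist `μ' = θ'E_{1,c}` and its `j`-th moment distribution `ν = θ'E_{j+1,c}`
  set μ' : (n : ℕ) → ZMod (p ^ n) → ℚ_[p] := bernoulliMeasure p N c θ' 1 with hμ'
  set ν : (n : ℕ) → ZMod (p ^ n) → ℚ_[p] := bernoulliMeasure p N c θ' (j + 1) with hν
  obtain ⟨C, hC1, hCν⟩ := exists_norm_bernoulliMeasure_sub_le p (θ := θ') hp hc
    (k := j + 1) (by omega)
  have hC : ∀ (n : ℕ) (a : ZMod (p ^ n)), ‖μ n a‖ ≤ C := fun n a ↦ (hbound n a).trans hC1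
  have hCinv : ∀ (n : ℕ) (a : ZMod (p ^ n)), ‖invUnitsDist μ n a‖ ≤ C :=
    fun n a ↦ (hbound' n a).trans hC1
  have hC' : ∀ (n : ℕ) (a : ZMod (p ^ n)), ‖μ' n a‖ ≤ C :=
    fun n a ↦ (norm_bernoulliMeasure_one_le_one p hp hc n a).trans hC1
  have hνdist : ∀ (n : ℕ) (a : ZMod (p ^ n)),
      ∑ b ∈ Finset.univ.filter (fun b : ZMod (p ^ (n + 1)) ↦
        ZMod.castHom (pow_dvd_pow p n.le_succ) (ZMod (p ^ n)) b = a), ν (n + 1) b = ν n a :=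
    sum_fiber_bernoulliMeasure hc hθ'N (by omega)
  have hνest : ∀ (n : ℕ) (a : ZMod (p ^ n)),
      ‖ν n a - ((a.val : ℕ) : ℚ_[p]) ^ j * μ' n a‖ ≤ C * (p : ℝ) ^ (-(n : ℤ)) := by
    intro n a
    have h := hCν n a
    rwa [Nat.add_sub_cancel] at h
  have htwist := bernoulliMeasure_twist p (N := N) (c := c) hθ'ω
  -- the value
  have hval : ν 0 0 - ν 1 0 =
      ((j + 1 : ℕ) : ℚ_[p])⁻¹ * (1 - ((θ' c : ℤ_[p]) : ℚ_[p]) * (c : ℚ_[p]) ^ (j + 1)) *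
        ((N : ℚ_[p]) ^ j * ∑ i ∈ Finset.range N, ((θ' i : ℤ_[p]) : ℚ_[p]) *
          (((Polynomial.bernoulli (j + 1)).eval ((i : ℚ) / N) : ℚ) : ℚ_[p])) := by
    rw [hν, bernoulliMeasure_zero_eq p hc hθ'N hθ'c (j + 1),
      bernoulliMeasure_one_zero_eq_zero p hθ'p (j + 1), sub_zero,
      sum_bernoulliDist_level_zero_eq p θ' (j + 1), Nat.add_sub_cancel]
  refine ⟨?_, ?_⟩
  · rw [← hval]
    exact hasSum_coeff_mul_cyclotomicGenerator_pow_sub_one_of_twist hC hC' hftend htwist hνdist hνest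
  · rw [← hval]
    exact hasSum_coeff_mul_cyclotomicGenerator_inv_pow_sub_one_of_twist hCinv hC' hgtend
      (fun n η s ↦ invUnitsDist_classMap n η s) htwist hνdist hνest

end Literature.NumberTheory.EllipticCurves

end
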